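import Summits.HodgeConjecture.HodgeConjecture.Theorems.F0P2oBorelTorusModulus                      -- ★ `rootDeltaChar_cmBorel_torus` (`δ_B^{1/2}(d(α,β,ᾱ⁻¹)) = ‖α‖`)
import Summits.HodgeConjecture.HodgeConjecture.Theorems.F0P3U3ConstituentEmbedsOfJacquet               -- ★ N2 ⇐ N1 `u3PrincipalSeriesConstituentEmbeds_of_jacquetFiltration`
import Summits.HodgeConjecture.HodgeConjecture.Theorems.F0P3cStCharTSUniqPar                          -- ★ `conjInvChar_normSqInv`, `conjInvChar_quadChar_mul_half`; brings ★ LdsFields ∕ `Gqs`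
import Summits.HodgeConjecture.HodgeConjecture.Theorems.F0P3U3PrincipalSeriesJacquetFiltrationHolds   -- ★ N1 hypothesis-free
import Literature.NumberTheory.Automorphic.SmoothInductionSphericalLine                                   -- ★ evaluation at `1` on `(Ind σ)^K`
import Literature.NumberTheory.Automorphic.EulerPoincareLengthTwoDichotomy                                -- ★ E1-28 §1 `fixedPoints_top_ne_bot_iff_forall`
import Literature.NumberTheory.Automorphic.CMXiTorusCharSplitTorusDecay                                   -- ★ `exists_map_eq_unitModulusChar_lt_one` (a `σ`-fixed unit of modulus `< 1`)
import Literature.NumberTheory.Automorphic.CMLocalRingModulusContinuous                                   -- ★ `continuous_cmXiTorusChar_fst`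
import HarnessLib

/-!
# No trivial constituent: the class of the trivial representation is a constituent of `i_G(χ₁, χ₂)` only at `χ₂ = 1`, `χ₁ = ‖·‖^{∓1}`
# (E1 ROW 35 «EP-CROSS (i) @ DATUM», input (C2); Rogawski 1990 §12.2, Bernstein–Zelevinsky 1977 §2.3, Casselman 1995 Cor. 6.3.9)

Cell `pub/hodgecm-mathlib`, crux H413 = `stmt-HodgeConjecture-24833`, LH6 leaf `Cruxes/H413/Lines/F0_P3c_StCharTSPaydown.lean`, organ (S-𝔑)
`stub_EllipticInputs`, consequent 3 (`h61bRest`, [Rogawski1990, Prop. 12.6.1 (b)]) — E1 row 35 (keeper F0P3a-p03 (g29); seat LH6-p03 (g9)).  THEOREMS ONLY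
(`--supports`, `--as helper`); no `def`, no instance, no notation, no `sorry`; nothing of the organ is restated.

WHAT.  The hypothesis `ha`∕`hb` of ★ E1-28 `IrrClass.ep_eq_zero_of_constituents_pair` («neither constituent is a representation on which `G` acts
trivially») for the principal series of `G = U(Φ₃)(L⁺_v)` at a non-split place:
* §1 (generic) `forall_apply_one_eq_one_of_fixedPoints_top_ne_bot` — for a LINE `σ : Representation k H k`, a non-zero `G`-fixed vector of `Ind_H^G σ` is a
  constant function, so `σ ≡ 1` (★ `SmoothInductionSphericalLine` at `K = ⊤`).
* §2 (CM torus) `cmTorusCharPair_mul_rootDeltaChar_eq_one_of_fixedPoints_top_ne_bot` — `i_G(χ)^{G} ≠ 0 ⇒ χ(t) · δ_B^{1∕2}(t) = 1` on `T`, and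
  `eq_of_fixedPoints_top_cmPrincipalSeries_ne_bot` — for `χ = (χ₁, χ₂)`: `χ₂ = 1 ∧ χ₁ = (‖·‖^{1∕2}·‖·‖^{1∕2})⁻¹` (★ `rootDeltaChar_cmBorel_torus`, `d(1, b, 1)`,
  `d(α, 1, ᾱ⁻¹)`).
* §3 (constituents) `eq_of_isConstituentOf_of_forall_apply_eq` — if a TRIVIAL-ACTION irreducible `r` has `⟦r⟧ ∈ JH(i_G(χ₁, χ₂))` then `χ₂ = 1` and
  `χ₁ = (‖·‖^{1∕2}‖·‖^{1∕2})⁻¹ ∨ χ₁ = ‖·‖^{1∕2}‖·‖^{1∕2}` (★ N2 «every constituent embeds into `i_G(χ)` or `i_G(wχ)`», holding in house via ★ N1;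
  `wχ = (χ̄₁⁻¹, χ₂)`, `‖σ·‖ = ‖·‖`).
* §4 (the two families of [Rogawski1990, §12.2]) `exists_apply_ne_of_isConstituentOf_caseTwo` — at the case-(2) data `χ_ξ = (η̃₁ μ ‖·‖^{1∕2}, η₂)` with
  `μ|_{F^×} = ω_{E∕F}` (★ `IsQuadraticCharExtension`), NO constituent is a trivial-action class; `exists_apply_ne_of_isConstituentOf_lds` — the same for
  the l.d.s. data (`χ₁|_{F^×} = 1`, `χ₁ ≠ 1`).  Witness: the `σ`-fixed norm `x = ϖ·σϖ` of a non-unit-modulus `ϖ` has `μ x = 1`, `η̃₁ x = 1`, `‖x‖ ≠ 1`.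

HONEST LABEL: count-neutral helper (E1 row 35 input); h413 OPEN; HC_CM is proved only modulo the 7 printed citations (2 remaining: hLiu418 =
stmt-HodgeConjecture-24832, h413 = stmt-HodgeConjecture-24833) until rung 0 closes.
## References
* [Rogawski1990] J. D. Rogawski, *Automorphic Representations of Unitary Groups in Three Variables*, Ann. of Math. Stud. 123 (1990), §12.1 p. 171, §12.2 pp. 173–174.
* [BernsteinZelevinsky1977] I. N. Bernstein, A. V. Zelevinsky, *Induced representations of reductive p-adic groups. I*, Ann. Sci. ÉNS 10 (1977), §2.3.
* [Casselman1995] W. Casselman, *Introduction to the theory of admissible representations of p-adic reductive groups* (1995), Cor. 6.3.9 (b) p. 60.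
* [CartierCorvallis1979] P. Cartier, *Representations of p-adic groups: a survey*, PSPM 33.1 (1979), §III.3.
-/

set_option autoImplicit false
set_option linter.dupNamespace false

noncomputable section

open MeasureTheory NumberField IsDedekindDomain Representation Literature.NumberTheory.Automorphic Literature.NumberTheory.Automorphic.UnitaryGroup
open Literature.NumberTheory.Rogawski1990 (Gqs)
open scoped MatrixGroups NNReal

namespace Summit.HodgeConjecture.HodgeConjecture.Cruxes.H413.F0P3cStCharTSNoTrivialConstituent

/-! ## §1 Generic: a non-zero `G`-fixed vector of `Ind_H^G σ` (`σ` a line) forces `σ ≡ 1` -/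

/-- **A non-zero `G`-fixed vector of `Ind_H^G σ`, `σ` on the line `k`, forces `σ h 1 = 1` for all `h ∈ H`**: a `G`-fixed `f` is determined by `f(1)` (it is the
constant function, ★ `eq_of_toFun_one_eq` at `K = ⊤`), so `f ≠ 0 ⇒ f(1) ≠ 0`; and `f(1) ∈ k^{σ(H)}` (★ `toFun_one_mem_fixedPoints_subgroupOf`) gives
`σ h (f 1) = (σ h 1) · f(1) = f(1)`. [cite: CartierCorvallis1979, §III.3] [cite: BernsteinZelevinsky1977, §2.3] -/
theorem forall_apply_one_eq_one_of_fixedPoints_top_ne_bot {k G : Type*} [Field k] [Group G] [TopologicalSpace G] [SeparatelyContinuousMul G]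
    (H : Subgroup G) (σ : Representation k H k) (hne : (smoothIndRep H σ).fixedPoints (⊤ : Subgroup G) ≠ ⊥) :
    ∀ h : H, σ h 1 = 1 := by
  obtain ⟨f, hf, hf0⟩ := (Submodule.ne_bot_iff _).1 hne
  have hGK : ∀ g : G, ∃ h : H, ∃ κ ∈ (⊤ : Subgroup G), g = h * κ := fun g => ⟨1, g, Subgroup.mem_top g, by rw [OneMemClass.coe_one, one_mul]⟩
  -- `f(1) ≠ 0`
  have hf1 : f.toFun 1 ≠ 0 := by
    intro h0
    apply hf0
    refine eq_of_toFun_one_eq σ hGK hf (Submodule.zero_mem _) ?_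
    rw [h0]
    rfl
  have hfix := toFun_one_mem_fixedPoints_subgroupOf H ⊤ σ hf
  intro h
  have e := (σ.mem_fixedPoints _ (f.toFun 1)).1 hfix h (Subgroup.mem_subgroupOf.2 (Subgroup.mem_top _))
  -- `σ h (f 1) = (σ h 1) * f 1`
  have hlin : σ h (f.toFun 1) = σ h 1 * f.toFun 1 := by
    conv_lhs => rw [← mul_one (f.toFun 1), ← smul_eq_mul, map_smul, smul_eq_mul, mul_comm]
  rw [hlin] at e
  exact mul_right_cancel₀ hf1 (e.trans (one_mul _).symm)

/-- **An injective intertwiner out of a non-zero trivial-action representation produces a non-zero `G`-fixed vector** in the target (the image of any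
non-zero vector). [cite: BernsteinZelevinsky1977, §2.3] -/
theorem fixedPoints_top_ne_bot_of_injective {k G V W : Type*} [CommRing k] [Group G] [AddCommGroup V] [Module k V] [AddCommGroup W] [Module k W]
    [Nontrivial V] {ρ : Representation k G V} {τ : Representation k G W} (f : ρ.IntertwiningMap τ) (hf : Function.Injective f)
    (htriv : ∀ (g : G) (w : V), ρ g w = w) : τ.fixedPoints (⊤ : Subgroup G) ≠ ⊥ := by
  obtain ⟨w, hw⟩ := exists_ne (0 : V)
  have hwfix : w ∈ ρ.fixedPoints (⊤ : Subgroup G) := (ρ.mem_fixedPoints ⊤ w).2 fun g _ => htriv g w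
  have hfw : f w ≠ 0 := fun h0 => hw (hf (by rw [h0, map_zero]))
  exact (Submodule.ne_bot_iff _).2 ⟨f w, map_mem_fixedPoints f ⊤ hwfix, hfw⟩

/-! ## §2 The CM torus: `i_G(χ)^{G} ≠ 0 ⇒ χ · δ_B^{1∕2} ≡ 1` on `T`, hence `χ₂ = 1`, `χ₁ = (‖·‖^{1∕2}‖·‖^{1∕2})⁻¹` -/

variable (L : Type) [Field L] [NumberField L] [IsCMField L] (v : HeightOneSpectrum (𝓞 ↥(maximalRealSubfield L)))

set_option maxHeartbeats 1600000 in
-- instance-path unification between the `cmPrincipalSeries` carrier and `smoothIndRep`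
/-- **`i_G(χ)^{G} ≠ 0 ⇒ χ(t) · δ_B^{1∕2}(t) = 1` for every `t ∈ T(L⁺_v)`** (§1 at the inducing line `χ∘proj ⊗ δ_B^{1∕2}` of ★ `cmPrincipalSeries`; `proj t = t`).
[cite: BernsteinZelevinsky1977, §2.3] [cite: Rogawski1990, §12.1 p. 171] -/
theorem apply_mul_rootDeltaChar_eq_one_of_fixedPoints_top_ne_bot
    (χ : ↥(torusU (conjLocal L (IsCMField.complexConj L) v) (cmLocalForm L 3 v)) →* ℂˣ)
    (hne : (cmPrincipalSeries L 3 v χ).fixedPoints (⊤ : Subgroup _) ≠ ⊥)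
    (t : ↥(torusU (conjLocal L (IsCMField.complexConj L) v) (cmLocalForm L 3 v))) :
    haveI := locallyCompactSpace_cmBorelU L 3 v
    ((χ t : ℂˣ) : ℂ) * ((rootDeltaChar (cmBorelTriple L 3 v).P ⟨(t : ↥(unitaryGroupOfForm _ _)), torusU_le_borelU _ _ t.2⟩ : ℂˣ) : ℂ) = 1 := by
  haveI := locallyCompactSpace_cmBorelU L 3 v
  set p : ↥(cmBorelTriple L 3 v).P := ⟨(t : ↥(unitaryGroupOfForm _ _)), torusU_le_borelU _ _ t.2⟩ with hp
  have key := forall_apply_one_eq_one_of_fixedPoints_top_ne_bot (cmBorelTriple L 3 v).P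
    (Representation.twist
      (((Representation.trivial ℂ ↥(torusU (conjLocal L (IsCMField.complexConj L) v) (cmLocalForm L 3 v)) ℂ).twist χ).comp
        (cmBorelTriple L 3 v).proj) (rootDeltaChar (cmBorelTriple L 3 v).P)) hne p
  have hproj : (cmBorelTriple L 3 v).proj p = t :=
    Subtype.ext ((cmBorelTriple L 3 v).proj_apply_of_mem_M p t.2)
  rw [Representation.twist_apply, MonoidHom.coe_comp, Function.comp_apply, hproj, Representation.twist_apply] at key
  have htriv : (Representation.trivial ℂ ↥(torusU (conjLocal L (IsCMField.complexConj L) v) (cmLocalForm L 3 v)) ℂ) t (1 : ℂ) = 1 := rfl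
  rw [htriv, smul_eq_mul, smul_eq_mul, mul_one, mul_comm] at key
  exact key

/-- `diag(α, b, (σα)⁻¹) ∈ U(Φ₃)(L⁺_v)` for `α ∈ L_v^×`, `b ∈ E¹_v` (torus relations `σ((σα)⁻¹)·α = 1`, `σb·b = 1`, `σα·(σα)⁻¹ = 1`).
[cite: Rogawski1990, §1.10 p. 9; §12.1 p. 171] -/
theorem glDiagonal_mem (α : (LocalRing L v)ˣ) (b : ↥(UnitaryGroup.normOneUnits (conjLocal L (IsCMField.complexConj L) v))) :
    glDiagonal 3 (LocalRing L v) ![α, (b : (LocalRing L v)ˣ), (Units.map (conjLocal L (IsCMField.complexConj L) v : LocalRing L v →* LocalRing L v) α)⁻¹] ∈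
      unitaryGroupOfForm (conjLocal L (IsCMField.complexConj L) v) (cmLocalForm L 3 v) := by
  rw [cmLocalForm_eq_over L 3 v, glDiagonal_mem_unitaryGroupOfForm_antidiagonal_iff]
  have hb := (UnitaryGroup.mem_normOneUnits_iff (b : (LocalRing L v)ˣ)).1 b.2
  have hσσ := conjLocal_conjLocal_cm L v
  set u : (LocalRing L v)ˣ := Units.map (conjLocal L (IsCMField.complexConj L) v : LocalRing L v →* LocalRing L v) α with hu
  have hucoe : ((u : (LocalRing L v)ˣ) : LocalRing L v) = conjLocal L (IsCMField.complexConj L) v (α : LocalRing L v) := rfl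
  have huinv : conjLocal L (IsCMField.complexConj L) v ((u⁻¹ : (LocalRing L v)ˣ) : LocalRing L v) = ((α⁻¹ : (LocalRing L v)ˣ) : LocalRing L v) := by
    have h1 : conjLocal L (IsCMField.complexConj L) v ((u⁻¹ : (LocalRing L v)ˣ) : LocalRing L v) =
        (((Units.map (conjLocal L (IsCMField.complexConj L) v : LocalRing L v →* LocalRing L v) u)⁻¹ : (LocalRing L v)ˣ) : LocalRing L v) := by
      rw [Units.coe_map_inv]; rfl
    have h2 : Units.map (conjLocal L (IsCMField.complexConj L) v : LocalRing L v →* LocalRing L v) u = α :=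
      Units.ext (by rw [Units.coe_map, hucoe]; exact hσσ _)
    rw [h1, h2]
  intro i
  fin_cases i
  · show conjLocal L (IsCMField.complexConj L) v ((u⁻¹ : (LocalRing L v)ˣ) : LocalRing L v) * (α : LocalRing L v) = 1
    rw [huinv, ← Units.val_mul, inv_mul_cancel, Units.val_one]
  · show conjLocal L (IsCMField.complexConj L) v (((b : (LocalRing L v)ˣ)) : LocalRing L v) * (((b : (LocalRing L v)ˣ)) : LocalRing L v) = 1
    exact hb
  · show conjLocal L (IsCMField.complexConj L) v (α : LocalRing L v) * ((u⁻¹ : (LocalRing L v)ˣ) : LocalRing L v) = 1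
    rw [← hucoe, ← Units.val_mul, mul_inv_cancel, Units.val_one]

/-- **The torus element `d(α, b, (σα)⁻¹)`** as a member of `T(L⁺_v)`, with its first entry `α` and its determinant read in `E¹_v`
(`det = α · b · (σα)⁻¹`). [cite: Rogawski1990, §1.10 p. 9; §12.1 p. 171] -/
theorem exists_torus_entry_det (α : (LocalRing L v)ˣ) (b : ↥(UnitaryGroup.normOneUnits (conjLocal L (IsCMField.complexConj L) v))) :
    ∃ t : ↥(torusU (conjLocal L (IsCMField.complexConj L) v) (cmLocalForm L 3 v)),
      torusEntry (conjLocal L (IsCMField.complexConj L) v) (cmLocalForm L 3 v) 0 t = α ∧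
      ((torusDetNormOne (conjLocal L (IsCMField.complexConj L) v) (cmLocalForm L 3 v) (cmLocalForm_eq_over L 3 v) t : ↥(UnitaryGroup.normOneUnits _)) : (LocalRing L v)ˣ) =
        α * (b : (LocalRing L v)ˣ) * (Units.map (conjLocal L (IsCMField.complexConj L) v : LocalRing L v →* LocalRing L v) α)⁻¹ := by
  set d : Fin 3 → (LocalRing L v)ˣ := ![α, (b : (LocalRing L v)ˣ), (Units.map (conjLocal L (IsCMField.complexConj L) v : LocalRing L v →* LocalRing L v) α)⁻¹] with hd
  let g : ↥(unitaryGroupOfForm (conjLocal L (IsCMField.complexConj L) v) (cmLocalForm L 3 v)) := ⟨glDiagonal 3 (LocalRing L v) d, glDiagonal_mem L v α b⟩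
  have hgT : g ∈ torusU (conjLocal L (IsCMField.complexConj L) v) (cmLocalForm L 3 v) := (mem_torusU_iff g).2 ⟨d, rfl⟩
  refine ⟨⟨g, hgT⟩, ?_, ?_⟩
  · rw [torusEntry_eq_of_glDiagonal_eq _ _ 0 ⟨g, hgT⟩ d rfl]; rfl
  · rw [coe_torusDetNormOne, torusDet_eq_of_glDiagonal_eq _ _ ⟨g, hgT⟩ d rfl, Fin.prod_univ_three]
    rfl

set_option maxHeartbeats 1600000 in
-- instance-path unification between the `cmPrincipalSeries` carrier and `smoothIndRep`
/-- **`i_G(χ₁, χ₂)^{G} ≠ 0 ⇒ χ₂ = 1 ∧ χ₁ = (‖·‖^{1∕2}·‖·‖^{1∕2})⁻¹`**: read `χ(t)·δ_B^{1∕2}(t) = 1` (§2) at `t = d(1, b, 1)` (`‖1‖ = 1`, `det = b`) and at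
`t = d(α, 1, (σα)⁻¹)` (`δ_B^{1∕2} = ‖α‖ = (‖α‖^{1∕2})²`, ★ `rootDeltaChar_cmBorel_torus`, ★ `halfModulusChar_sq`).  The only principal series of `U(3)` with a
`G`-fixed vector is `i_G(‖·‖^{−1}, 1) = i_G(δ_B^{−1∕2})` (it contains the constants). [cite: Rogawski1990, §12.1 p. 171; §12.2 (1) p. 173] [cite: BernsteinZelevinsky1977, §2.3] -/
theorem eq_of_fixedPoints_top_cmPrincipalSeries_ne_bot (χ₁ : (LocalRing L v)ˣ →* ℂˣ)
    (χ₂ : ↥(UnitaryGroup.normOneUnits (conjLocal L (IsCMField.complexConj L) v)) →* ℂˣ)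
    (hne : (cmPrincipalSeries L 3 v (cmTorusCharPair L v χ₁ χ₂)).fixedPoints (⊤ : Subgroup _) ≠ ⊥) :
    χ₂ = 1 ∧ χ₁ = (halfModulusChar (LocalRing L v) * halfModulusChar (LocalRing L v))⁻¹ := by
  haveI := locallyCompactSpace_cmBorelU L 3 v
  have key := apply_mul_rootDeltaChar_eq_one_of_fixedPoints_top_ne_bot L v (cmTorusCharPair L v χ₁ χ₂) hne
  -- the value of `χ · δ^{1/2}` at `d(α, b, (σα)⁻¹)`
  have hval : ∀ (α : (LocalRing L v)ˣ) (b : ↥(UnitaryGroup.normOneUnits (conjLocal L (IsCMField.complexConj L) v))),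
      ∃ t : ↥(torusU (conjLocal L (IsCMField.complexConj L) v) (cmLocalForm L 3 v)),
        torusEntry (conjLocal L (IsCMField.complexConj L) v) (cmLocalForm L 3 v) 0 t = α ∧
        ((torusDetNormOne (conjLocal L (IsCMField.complexConj L) v) (cmLocalForm L 3 v) (cmLocalForm_eq_over L 3 v) t : ↥(UnitaryGroup.normOneUnits _)) : (LocalRing L v)ˣ) =
          α * (b : (LocalRing L v)ˣ) * (Units.map (conjLocal L (IsCMField.complexConj L) v : LocalRing L v →* LocalRing L v) α)⁻¹ ∧
        ((χ₁ α : ℂˣ) : ℂ) * ((χ₂ (torusDetNormOne (conjLocal L (IsCMField.complexConj L) v) (cmLocalForm L 3 v) (cmLocalForm_eq_over L 3 v) t) : ℂˣ) : ℂ) *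
          (((unitModulusChar (LocalRing L v) α : ℝ≥0) : ℝ) : ℂ) = 1 := by
    intro α b
    obtain ⟨t, ht0, htdet⟩ := exists_torus_entry_det L v α b
    refine ⟨t, ht0, htdet, ?_⟩
    have h := key t
    rw [F0P2oBorelTorusModulus.rootDeltaChar_cmBorel_torus L v t, ht0] at h
    have hχ : ((cmTorusCharPair L v χ₁ χ₂ t : ℂˣ) : ℂ) =
        ((χ₁ α : ℂˣ) : ℂ) * ((χ₂ (torusDetNormOne (conjLocal L (IsCMField.complexConj L) v) (cmLocalForm L 3 v) (cmLocalForm_eq_over L 3 v) t) : ℂˣ) : ℂ) := by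
      rw [cmTorusCharPair, torusCharPair_apply, ht0, Units.val_mul]
    rw [hχ] at h
    exact h
  -- `χ₂ = 1`: at `α = 1`, `det = b`, `‖1‖ = 1`
  have h2 : χ₂ = 1 := by
    refine MonoidHom.ext fun b => ?_
    obtain ⟨t, -, htdet, h⟩ := hval 1 b
    rw [map_one, inv_one, mul_one, one_mul] at htdet
    have hb : torusDetNormOne (conjLocal L (IsCMField.complexConj L) v) (cmLocalForm L 3 v) (cmLocalForm_eq_over L 3 v) t = b := Subtype.ext htdet
    rw [hb, map_one, Units.val_one, one_mul, map_one, NNReal.coe_one, Complex.ofReal_one, mul_one] at h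
    rw [MonoidHom.one_apply]
    exact Units.ext h
  refine ⟨h2, MonoidHom.ext fun α => ?_⟩
  -- `χ₁ = (hM·hM)⁻¹`: at `b = 1`, with `χ₂ = 1`
  obtain ⟨t, -, -, h⟩ := hval α 1
  rw [h2, MonoidHom.one_apply, Units.val_one, mul_one] at h
  apply Units.ext
  rw [MonoidHom.inv_apply, MonoidHom.mul_apply, Units.val_inv_eq_inv_val, Units.val_mul, ← sq, halfModulusChar_sq]
  exact eq_inv_of_mul_eq_one_left h

/-! ## §3 Constituents: a trivial-action class in `JH(i_G(χ₁, χ₂))` forces `χ₂ = 1`, `χ₁ ∈ {(‖·‖^{1∕2})⁻², (‖·‖^{1∕2})²}` -/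

set_option maxHeartbeats 1600000 in
set_option synthInstance.maxHeartbeats 400000 in
-- elaboration of the `cmPrincipalSeries` carrier
/-- **NO TRIVIAL CONSTITUENT OFF `W·δ_B^{−1∕2}`**: if an irreducible `r` on which `G` acts TRIVIALLY has `⟦r⟧ ∈ JH(i_G(χ₁, χ₂))` (`χ₁`, `χ₂` continuous, `v`
non-split), then `χ₂ = 1` and `χ₁ = (‖·‖^{1∕2}‖·‖^{1∕2})⁻¹ ∨ χ₁ = ‖·‖^{1∕2}‖·‖^{1∕2}`.  By ★ N2 (holding in house over ★ N1) a representative of `⟦r⟧` EMBEDS into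
`i_G(χ)` or `i_G(wχ)`; the image of a non-zero vector is a non-zero `G`-fixed vector there (class invariance of «`G` acts trivially», ★ E1-28 §1), so §2
applies to `χ` or to `wχ = (χ̄₁⁻¹, χ₂)` (★ `conjInvChar_normSqInv`: `w((‖·‖^{1∕2}‖·‖^{1∕2})⁻¹) = ‖·‖^{1∕2}‖·‖^{1∕2}`).
[cite: Casselman1995, Cor. 6.3.9 (b) p. 60] [cite: BernsteinZelevinsky1977, §2.3] [cite: Rogawski1990, §12.2 p. 173] -/
theorem eq_of_isConstituentOf_of_forall_apply_eq (hns : ∀ w : PlacesOver L v, IsCMField.complexConj L • w.1 = w.1)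
    (χ₁ : (LocalRing L v)ˣ →* ℂˣ) (χ₂ : ↥(UnitaryGroup.normOneUnits (conjLocal L (IsCMField.complexConj L) v)) →* ℂˣ)
    (hχ₁ : Continuous fun x => ((χ₁ x : ℂˣ) : ℂ)) (hχ₂ : Continuous fun x => ((χ₂ x : ℂˣ) : ℂ))
    {r : SmoothIrrep ↥(unitaryGroupOfForm (conjLocal L (IsCMField.complexConj L) v) (cmLocalForm L 3 v))}
    (htriv : ∀ (g : ↥(unitaryGroupOfForm (conjLocal L (IsCMField.complexConj L) v) (cmLocalForm L 3 v))) (w : r.V), r.ρ g w = w)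
    (hcon : (IrrClass.mk r).IsConstituentOf (cmPrincipalSeries L 3 v (cmTorusCharPair L v χ₁ χ₂))) :
    χ₂ = 1 ∧ (χ₁ = (halfModulusChar (LocalRing L v) * halfModulusChar (LocalRing L v))⁻¹ ∨
      χ₁ = halfModulusChar (LocalRing L v) * halfModulusChar (LocalRing L v)) := by
  have hN2 := F0P3U3ConstituentEmbedsOfJacquet.u3PrincipalSeriesConstituentEmbeds_of_jacquetFiltration L
    (F0P3U3PrincipalSeriesJacquetFiltrationHolds.U3PrincipalSeriesJacquetFiltration_holds L)
  obtain ⟨r', hr', hemb⟩ := hN2 v hns χ₁ χ₂ hχ₁ hχ₂ (IrrClass.mk r) hcon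
  -- `G` acts trivially on `r'` too (class invariance of «`V^G = 0`»)
  have h1 : r.ρ.fixedPoints (⊤ : Subgroup ↥(unitaryGroupOfForm (conjLocal L (IsCMField.complexConj L) v) (cmLocalForm L 3 v))) ≠ ⊥ := (fixedPoints_top_ne_bot_iff_forall r.ρ).2 htriv
  have h2 : r'.ρ.fixedPoints (⊤ : Subgroup ↥(unitaryGroupOfForm (conjLocal L (IsCMField.complexConj L) v) (cmLocalForm L 3 v))) ≠ ⊥ := fun h =>
    h1 ((IrrClass.fixedPoints_eq_bot_iff_of_mk_eq_mk hr' ⊤).1 h)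
  have htriv' : ∀ (g : ↥(unitaryGroupOfForm (conjLocal L (IsCMField.complexConj L) v) (cmLocalForm L 3 v))) (w : r'.V), r'.ρ g w = w := (fixedPoints_top_ne_bot_iff_forall r'.ρ).1 h2
  haveI := IrrClass.nontrivial_of_isIrreducible r'.ρ
  rcases hemb with ⟨f, hf⟩ | ⟨f, hf⟩
  · -- a non-zero `G`-fixed vector of `i_G(χ)`
    obtain ⟨h2', h1'⟩ := eq_of_fixedPoints_top_cmPrincipalSeries_ne_bot L v χ₁ χ₂ (fixedPoints_top_ne_bot_of_injective f hf htriv')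
    exact ⟨h2', Or.inl h1'⟩
  · -- the same in `i_G(wχ)`, `wχ = (χ̄₁⁻¹, χ₂)`
    obtain ⟨h2', h1'⟩ := eq_of_fixedPoints_top_cmPrincipalSeries_ne_bot L v
      (conjInvChar (conjLocal L (IsCMField.complexConj L) v) χ₁) χ₂ (fixedPoints_top_ne_bot_of_injective f hf htriv')
    refine ⟨h2', Or.inr ?_⟩
    have h := congrArg (conjInvChar (conjLocal L (IsCMField.complexConj L) v)) h1'
    rwa [F0P2pTorusPairsAndVacuity.conjInvChar_conjInvChar _ (conjLocal_conjLocal_cm L v),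
      F0P3cStCharTSUniqPar.conjInvChar_normSqInv] at h

/-! ## §4 The two reducible families of [Rogawski1990, §12.2]: no trivial-action constituent -/

/-- **A `σ`-fixed NORM of modulus `< 1`**: `x = a·a = σ(a)·a` for the `σ`-fixed unit `a` of ★ `exists_map_eq_unitModulusChar_lt_one` (`‖x‖ = ‖a‖² < 1`).
On such an `x`: `quotConj x = 1`, every `μ` with `μ|_{F^×} = ω_{E∕F}` (★ `IsQuadraticCharExtension`) has `μ x = 1`, and `‖x‖ ≠ 1`.
[cite: Rogawski1990, §4.8 p. 51; §12.2 p. 173] -/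
theorem exists_fixed_norm_unitModulusChar_lt_one :
    ∃ x a : (LocalRing L v)ˣ, conjLocal L (IsCMField.complexConj L) v (x : LocalRing L v) = x ∧
      conjLocal L (IsCMField.complexConj L) v (a : LocalRing L v) * a = x ∧ unitModulusChar (LocalRing L v) x < 1 := by
  obtain ⟨a, ha, hlt⟩ := exists_map_eq_unitModulusChar_lt_one L v (conjLocal L (IsCMField.complexConj L) v)
  refine ⟨a * a, a, ?_, ?_, ?_⟩
  · rw [Units.val_mul, map_mul, ha]
  · rw [Units.val_mul, ha]
  · rw [map_mul]
    exact mul_lt_one_of_nonneg_of_lt_one_left zero_le hlt hlt.le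

omit [IsCMField L] in
/-- `‖·‖^{1∕2}‖·‖^{1∕2}` is NOT `1` at a unit of modulus `< 1`, and neither is its inverse. [cite: Rogawski1990, §12.2 p. 173] -/
theorem halfModulusChar_mul_self_apply_ne_one {x : (LocalRing L v)ˣ} (hx : unitModulusChar (LocalRing L v) x < 1) :
    (halfModulusChar (LocalRing L v) * halfModulusChar (LocalRing L v)) x ≠ 1 ∧
      (halfModulusChar (LocalRing L v) * halfModulusChar (LocalRing L v))⁻¹ x ≠ 1 := by
  have key : (((halfModulusChar (LocalRing L v) * halfModulusChar (LocalRing L v)) x : ℂˣ) : ℂ) ≠ 1 := by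
    rw [MonoidHom.mul_apply, Units.val_mul, ← sq, halfModulusChar_sq]
    exact_mod_cast hx.ne
  refine ⟨fun h => key (by rw [h, Units.val_one]), fun h => key ?_⟩
  rw [MonoidHom.inv_apply, inv_eq_one] at h
  rw [h, Units.val_one]

/-- **CASE (2): no trivial-action constituent of `i_G(χ_ξ)`, `χ_ξ = (η̃₁ μ ‖·‖^{1∕2}, η₂)`, `μ|_{F^×} = ω_{E∕F}`** — so neither `π²(ξ)` nor `πⁿ(ξ)` is a
class with a non-zero `G`-fixed vector (the `ha`∕`hb` of ★ E1-28).  By §3 a trivial-action constituent forces `η̃₁ μ ‖·‖^{1∕2} = (‖·‖^{1∕2})^{∓2}`; at the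
`σ`-fixed norm `x` of §4 the left side is `‖x‖^{1∕2}` (`η̃₁ x = μ x = 1`) and the right side is `‖x‖^{∓1}`, impossible for `‖x‖ < 1`.
[cite: Rogawski1990, §12.2 (2) pp. 173–174; §4.8 p. 51] [cite: Casselman1995, Cor. 6.3.9 (b) p. 60] -/
theorem forall_apply_eq_false_of_isConstituentOf_caseTwo (hns : ∀ w : PlacesOver L v, IsCMField.complexConj L • w.1 = w.1)
    (μv : (LocalRing L v)ˣ →* ℂˣ) (hμ : IsQuadraticCharExtension (conjLocal L (IsCMField.complexConj L) v) μv)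
    (η₁ η₂ : ↥(UnitaryGroup.normOneUnits (conjLocal L (IsCMField.complexConj L) v)) →* ℂˣ)
    (hμc : Continuous fun x => ((μv x : ℂˣ) : ℂ)) (h1c : Continuous fun x => ((η₁ x : ℂˣ) : ℂ)) (h2c : Continuous fun x => ((η₂ x : ℂˣ) : ℂ))
    {r : SmoothIrrep ↥(unitaryGroupOfForm (conjLocal L (IsCMField.complexConj L) v) (cmLocalForm L 3 v))}
    (hcon : (IrrClass.mk r).IsConstituentOf (cmPrincipalSeries L 3 v (cmXiTorusChar L v μv η₁ η₂))) :
    ∃ (g : ↥(unitaryGroupOfForm (conjLocal L (IsCMField.complexConj L) v) (cmLocalForm L 3 v))) (w : r.V), r.ρ g w ≠ w := by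
  by_contra htriv
  push Not at htriv
  rw [cmXiTorusChar_eq_cmTorusCharPair] at hcon
  obtain ⟨-, h⟩ := eq_of_isConstituentOf_of_forall_apply_eq L v hns _ η₂ (continuous_cmXiTorusChar_fst L v μv η₁ hμc h1c) h2c htriv hcon
  obtain ⟨x, a, hx, hax, hlt⟩ := exists_fixed_norm_unitModulusChar_lt_one L v
  obtain ⟨hne, hne'⟩ := halfModulusChar_mul_self_apply_ne_one L v hlt
  -- the left side at `x`: `η₁(x∕x̄) · μ(x) · ‖x‖^{1/2} = ‖x‖^{1/2}`
  have hq : quotConj (conjLocal L (IsCMField.complexConj L) v) (conjLocal_conjLocal_cm L v) x = 1 := by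
    apply Subtype.ext
    rw [coe_quotConj, OneMemClass.coe_one]
    have hmx : Units.map (conjLocal L (IsCMField.complexConj L) v : LocalRing L v →* LocalRing L v) x = x := Units.ext hx
    rw [hmx, mul_inv_cancel]
  have hμx : μv x = 1 := (hμ x hx).2 ⟨a, hax⟩
  have hlhs : (η₁.comp (quotConj (conjLocal L (IsCMField.complexConj L) v) (conjLocal_conjLocal_cm L v)) * μv * halfModulusChar (LocalRing L v)) x =
      halfModulusChar (LocalRing L v) x := by
    rw [MonoidHom.mul_apply, MonoidHom.mul_apply, MonoidHom.comp_apply, hq, map_one, hμx, one_mul, one_mul]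
  rcases h with h | h
  · -- `‖x‖^{1/2} = ‖x‖⁻¹`: then `(‖x‖^{1/2})³ = 1`, so `‖x‖ = 1`
    have e := congrArg (fun χ : (LocalRing L v)ˣ →* ℂˣ => χ x) h
    rw [hlhs, MonoidHom.inv_apply, MonoidHom.mul_apply] at e
    have hu3' : halfModulusChar (LocalRing L v) x * (halfModulusChar (LocalRing L v) x * halfModulusChar (LocalRing L v) x) = 1 :=
      eq_inv_iff_mul_eq_one.1 e
    have hu3 : (((halfModulusChar (LocalRing L v) x : ℂˣ) : ℂ)) ^ 3 = 1 := by
      have h3 := congrArg (fun z : ℂˣ => (z : ℂ)) hu3'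
      simp only [Units.val_mul, Units.val_one] at h3
      rw [← h3]; ring
    rw [coe_halfModulusChar_apply] at hu3
    have hs : ((NNReal.sqrt (unitModulusChar (LocalRing L v) x) : ℝ≥0) : ℝ) = 1 := by
      have h3 : (((NNReal.sqrt (unitModulusChar (LocalRing L v) x) : ℝ≥0) : ℝ)) ^ 3 = 1 := by exact_mod_cast hu3
      exact (pow_eq_one_iff_of_nonneg (NNReal.coe_nonneg _) (by norm_num)).1 h3
    have hux : unitModulusChar (LocalRing L v) x = 1 := by
      have h1 : NNReal.sqrt (unitModulusChar (LocalRing L v) x) = 1 := by exact_mod_cast hs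
      rw [← NNReal.sq_sqrt (unitModulusChar (LocalRing L v) x), h1, one_pow]
    exact hlt.ne hux
  · -- `‖x‖^{1/2} = ‖x‖`: then `‖x‖^{1/2} = 1`
    have e := congrArg (fun χ : (LocalRing L v)ˣ →* ℂˣ => χ x) h
    rw [hlhs, MonoidHom.mul_apply] at e
    have hu1 : halfModulusChar (LocalRing L v) x = 1 :=
      mul_left_cancel (a := halfModulusChar (LocalRing L v) x) (by rw [mul_one]; exact e.symm)
    exact hne (by rw [MonoidHom.mul_apply, hu1, one_mul])

/-- **L.D.S.: no trivial-action constituent of `i_G(χ₁, χ₂)` when `χ₁` is trivial on the `σ`-fixed units** (the l.d.s. data «`χ₁|_{F^×} = 1`» of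
[Rogawski1990, §12.2 (3)]): by §3 such a constituent forces `χ₁ = (‖·‖^{1∕2})^{∓2}`, but `‖x‖ ≠ 1` at the `σ`-fixed unit `x` of §4 while `χ₁ x = 1`.
[cite: Rogawski1990, §12.2 (3) p. 174] [cite: Casselman1995, Cor. 6.3.9 (b) p. 60] -/
theorem forall_apply_eq_false_of_isConstituentOf_fixedTrivial (hns : ∀ w : PlacesOver L v, IsCMField.complexConj L • w.1 = w.1)
    (χ₁ : (LocalRing L v)ˣ →* ℂˣ) (χ₂ : ↥(UnitaryGroup.normOneUnits (conjLocal L (IsCMField.complexConj L) v)) →* ℂˣ)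
    (hχ₁ : Continuous fun x => ((χ₁ x : ℂˣ) : ℂ)) (hχ₂ : Continuous fun x => ((χ₂ x : ℂˣ) : ℂ))
    (hfix : ∀ a : (LocalRing L v)ˣ, conjLocal L (IsCMField.complexConj L) v (a : LocalRing L v) = a → χ₁ a = 1)
    {r : SmoothIrrep ↥(unitaryGroupOfForm (conjLocal L (IsCMField.complexConj L) v) (cmLocalForm L 3 v))}
    (hcon : (IrrClass.mk r).IsConstituentOf (cmPrincipalSeries L 3 v (cmTorusCharPair L v χ₁ χ₂))) :
    ∃ (g : ↥(unitaryGroupOfForm (conjLocal L (IsCMField.complexConj L) v) (cmLocalForm L 3 v))) (w : r.V), r.ρ g w ≠ w := by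
  by_contra htriv
  push Not at htriv
  obtain ⟨-, h⟩ := eq_of_isConstituentOf_of_forall_apply_eq L v hns χ₁ χ₂ hχ₁ hχ₂ htriv hcon
  obtain ⟨x, a, hx, -, hlt⟩ := exists_fixed_norm_unitModulusChar_lt_one L v
  obtain ⟨hne, hne'⟩ := halfModulusChar_mul_self_apply_ne_one L v hlt
  have h1 := hfix x hx
  rcases h with h | h
  · exact hne' (by rw [← h]; exact h1)
  · exact hne (by rw [← h]; exact h1)

end Summit.HodgeConjecture.HodgeConjecture.Cruxes.H413.F0P3cStCharTSNoTrivialConstituent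

end
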